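import Mathlib
import Summits.ResolutionOfSingularities.ResolutionOfSingularities.Theorems.WeightedInvariantLocalWeightedDropNCResSurfGraphTwist

/-!
# `WeightedInvariant.LocalWeightedDrop`: NC-resolution settings for the TOT₂ line — GRAPH SURFACES, part 28: A NORMAL-CROSSING SHADOW IS MONOMIAL
# AFTER ONE RE-COORDINATISATION OF THE BASE PLANE

Crux item stmt-ResolutionOfSingularities-8899 `LocalWeightedDrop` (route `ResolutionOfSingularities/WeightedInvariant`), ENGINE skeleton v34/v35, residual
`stub_wildWideApexFourStartsWon`; res-L1-w43-strat-1's line `directrix-cut` v3f, piece PL₃, sub-skeleton `pl3_split_v1` (7519a9009475ab47), stub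
`stub_apexPlaneSurfaceThree` = the SURFACE sub-case `ApexPlaneSurfaceExit`, reduced (…NCResSurfGraphRegime) to the loop `SurfLoop k m`; design memo
`L/res-L1-w43-stub-4/g6/SURFLOOP-DESIGN.md` §2.  [OURS · L1 W4.3 · chain w43 · seat res-L1-w43-stub-4 gen 6; def-free, on parts 19 and 27, the plane-germ
calculus `PlaneGerm.exists_eq_of_dvd_normalCrossing` and the formal inverse function theorem; nothing here is a statement of any manuscript; AI-produced,
gate-checked, weaker than expert review.]

* `factorBasis_of_isNC` — if a plane germ `P` has normal-crossing support (`P∘Φ = u·x₀^A x₁^C`), then with `Λ` the inverse coordinate change every divisor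
  of `P` is `unit · Λ₀^p · Λ₁^q`;
* `exps_of_X_eq` — a coordinate `x_s` written as `unit · F^p · G^q` with `F(0) = G(0) = 0` has `p + q = 1`;
* **`exists_monomial_twist`** — for a valid loop state whose SHADOW IS A NORMAL CROSSING there is a legal `Θ` of the base plane, the identity on the base
  letters that are boundary letters, such that the twisted state is MONOMIAL (every off-base boundary trace is `0` or `unit·x₀^p x₁^q`).  The four cases
  `a ∈ E?`, `b ∈ E?`: the boundary base letters are branches of the shadow, hence coordinates of `Λ` up to units; the remaining coordinate of `Θ⁻¹` is the
  other branch.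
-/

set_option linter.dupNamespace false -- mandated namespace of this single-conjunct summit

noncomputable section

namespace Summit.ResolutionOfSingularities.ResolutionOfSingularities.Theorems

namespace TameFourTupleDrop

namespace GraphSurf

open MvPowerSeries Literature.AlgebraicGeometry.Resolution

variable {k : Type} [Field k] {m : ℕ}

/-! ## Factor bases of normal-crossing plane germs -/

/-- **FACTOR BASIS.**  If `P ≠ 0` has normal-crossing support, there is a legal `Λ` (the inverse of the straightening coordinates) such that every divisor
of `P` is a unit times `Λ₀^p Λ₁^q`. -/
theorem factorBasis_of_isNC {P : MvPowerSeries (Fin 2) k} (hnc : PlaneGerm.IsNC P) :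
    ∃ Λ : Fin 2 → MvPowerSeries (Fin 2) k, (∀ t, constantCoeff (Λ t) = 0) ∧ IsUnit (FormalCoordChange.linMat Λ).det ∧
      ∀ F : MvPowerSeries (Fin 2) k, F ∣ P →
        ∃ (v : MvPowerSeries (Fin 2) k) (p q : ℕ), constantCoeff v ≠ 0 ∧ F = v * Λ 0 ^ p * Λ 1 ^ q := by
  obtain ⟨Φ, u, A, C, hΦ0, hΦdet, hu, hfac⟩ := hnc
  obtain ⟨Λ, hΛ0, hΛΦ, hΦΛ⟩ := FormalCoordChange.exists_comp_inverse hΦ0 hΦdet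
  have hΦ : HasSubst Φ := hasSubst_of_constantCoeff_zero hΦ0
  have hΛ : HasSubst Λ := hasSubst_of_constantCoeff_zero hΛ0
  refine ⟨Λ, hΛ0, TOT2E1.isUnit_det_linMat_of_comp_eq_X hΛ0 hΛΦ, fun F hF => ?_⟩
  have hd : subst Φ F ∣ u * X 0 ^ A * X 1 ^ C := by
    have h := map_dvd (substAlgHom hΦ) hF
    rwa [coe_substAlgHom, hfac] at h
  obtain ⟨v, p, q, hv, hvF⟩ := PlaneGerm.exists_eq_of_dvd_normalCrossing hu hd
  have hback : subst Λ (subst Φ F) = F := by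
    rw [subst_comp_subst_apply hΦ hΛ, show (fun s => subst Λ (Φ s)) = X from funext hΛΦ]
    exact congrFun subst_self _
  refine ⟨subst Λ v, p, q, by rwa [TOT2E1.constantCoeff_subst_of_constantCoeff_zero _ hΛ0], ?_⟩
  rw [← hback, hvF, ← coe_substAlgHom hΛ, map_mul, map_mul, map_pow, map_pow, coe_substAlgHom, subst_X hΛ, subst_X hΛ]

/-- The factor basis with its two coordinates exchanged. -/
theorem factorBasis_swap {P : MvPowerSeries (Fin 2) k} {Λ : Fin 2 → MvPowerSeries (Fin 2) k} (hΛ0 : ∀ t, constantCoeff (Λ t) = 0)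
    (hΛdet : IsUnit (FormalCoordChange.linMat Λ).det)
    (hfb : ∀ F : MvPowerSeries (Fin 2) k, F ∣ P → ∃ (v : MvPowerSeries (Fin 2) k) (p q : ℕ), constantCoeff v ≠ 0 ∧ F = v * Λ 0 ^ p * Λ 1 ^ q) :
    (∀ t, constantCoeff ((![Λ 1, Λ 0] : Fin 2 → MvPowerSeries (Fin 2) k) t) = 0) ∧
      IsUnit (FormalCoordChange.linMat (![Λ 1, Λ 0] : Fin 2 → MvPowerSeries (Fin 2) k)).det ∧
      ∀ F : MvPowerSeries (Fin 2) k, F ∣ P → ∃ (v : MvPowerSeries (Fin 2) k) (p q : ℕ), constantCoeff v ≠ 0 ∧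
        F = v * (![Λ 1, Λ 0] : Fin 2 → MvPowerSeries (Fin 2) k) 0 ^ p * (![Λ 1, Λ 0] : Fin 2 → MvPowerSeries (Fin 2) k) 1 ^ q := by
  refine ⟨fun t => by fin_cases t <;> simp [hΛ0], ?_, fun F hF => ?_⟩
  · rw [Matrix.det_fin_two] at hΛdet ⊢
    simp only [FormalCoordChange.linMat, Matrix.of_apply, Matrix.cons_val_zero, Matrix.cons_val_one] at hΛdet ⊢
    rw [isUnit_iff_ne_zero] at hΛdet ⊢
    intro h
    apply hΛdet
    linear_combination (-1 : k) * h
  · obtain ⟨v, p, q, hv, hF'⟩ := hfb F hF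
    exact ⟨v, q, p, hv, by rw [hF']; simp only [Matrix.cons_val_zero, Matrix.cons_val_one]; ring⟩

/-- A COORDINATE WRITTEN IN A FACTOR BASIS has exponents summing to one. -/
theorem exps_of_X_eq {v F G : MvPowerSeries (Fin 2) k} (hv : constantCoeff v ≠ 0) (hF : constantCoeff F = 0) (hG : constantCoeff G = 0)
    {p q : ℕ} {s : Fin 2} (h : (X s : MvPowerSeries (Fin 2) k) = v * F ^ p * G ^ q) : (p = 1 ∧ q = 0) ∨ (p = 0 ∧ q = 1) := by
  by_cases h0 : p = 0 ∧ q = 0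
  · obtain ⟨rfl, rfl⟩ := h0
    rw [pow_zero, pow_zero, mul_one, mul_one] at h
    exact absurd (by rw [← h, constantCoeff_X]) hv
  · by_contra hne
    have hpq : 2 ≤ p + q := by omega
    have hord : (2 : ℕ∞) ≤ (v * F ^ p * G ^ q).order := by
      have h1 := le_order_pow_of_constantCoeff_eq_zero p hF
      have h2 := le_order_pow_of_constantCoeff_eq_zero q hG
      calc (2 : ℕ∞) ≤ (p : ℕ∞) + (q : ℕ∞) := by exact_mod_cast hpq
        _ ≤ (F ^ p).order + (G ^ q).order := add_le_add h1 h2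
        _ ≤ (F ^ p * G ^ q).order := le_order_mul
        _ ≤ v.order + (F ^ p * G ^ q).order := le_add_self
        _ ≤ (v * (F ^ p * G ^ q)).order := le_order_mul
        _ = (v * F ^ p * G ^ q).order := by rw [mul_assoc]
    have hcoeff : coeff (Finsupp.single s 1) (v * F ^ p * G ^ q) = 0 := by
      apply coeff_of_lt_order
      refine lt_of_lt_of_le ?_ hord
      rw [Finsupp.degree_single]
      exact_mod_cast Nat.one_lt_two
    rw [← h, coeff_X, if_pos rfl] at hcoeff
    exact one_ne_zero hcoeff

/-- The degree-one coefficients of `unit · x_t`. -/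
theorem coeff_single_unit_mul_X (w : MvPowerSeries (Fin 2) k) (s t : Fin 2) :
    coeff (Finsupp.single s 1) (w * X t) = if s = t then constantCoeff w else 0 := by
  rw [X, coeff_mul_monomial, mul_one]
  by_cases h : s = t
  · subst h
    rw [if_pos le_rfl, if_pos rfl, tsub_self, coeff_zero_eq_constantCoeff]
  · rw [if_neg, if_neg h]
    intro hle
    have := hle t
    simp [Ne.symm h] at this

/-- A coordinate in the factor basis is a unit times one of the two basis series. -/
theorem X_eq_unit_mul_of_factorBasis {Λ : Fin 2 → MvPowerSeries (Fin 2) k} (hΛ0 : ∀ t, constantCoeff (Λ t) = 0) {v : MvPowerSeries (Fin 2) k}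
    (hv : constantCoeff v ≠ 0) {p q : ℕ} {s : Fin 2} (h : (X s : MvPowerSeries (Fin 2) k) = v * Λ 0 ^ p * Λ 1 ^ q) :
    (X s : MvPowerSeries (Fin 2) k) = v * Λ 0 ∨ (X s : MvPowerSeries (Fin 2) k) = v * Λ 1 := by
  rcases exps_of_X_eq hv (hΛ0 0) (hΛ0 1) h with ⟨rfl, rfl⟩ | ⟨rfl, rfl⟩
  · left; rw [h, pow_one, pow_zero, mul_one]
  · right; rw [h, pow_zero, pow_one, mul_one]

/-- Inverting a unit relation: `x_s = v · L` gives `L = v⁻¹ · x_s`. -/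
theorem eq_inv_mul_X_of {v L : MvPowerSeries (Fin 2) k} (hv : constantCoeff v ≠ 0) {s : Fin 2} (h : (X s : MvPowerSeries (Fin 2) k) = v * L) :
    L = v⁻¹ * X s := by
  rw [h, ← mul_assoc, MvPowerSeries.inv_mul_cancel _ hv, one_mul]

/-! ## The monomial twist of a normal-crossing loop state -/

namespace SurfDatum

open Classical in
/-- Every off-base boundary trace with non-zero value divides the shadow; so do the boundary base letters' coordinates. -/
theorem dvd_shadow (σ : SurfDatum k m) :
    (σ.a ∈ σ.δ.E → (X 0 : MvPowerSeries (Fin 2) k) ∣ σ.shadow) ∧ (σ.b ∈ σ.δ.E → (X 1 : MvPowerSeries (Fin 2) k) ∣ σ.shadow) ∧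
      ∀ l ∈ σ.off, σ.ψ l ≠ 0 → σ.ψ l ∣ σ.shadow := by
  refine ⟨fun ha => ?_, fun hb => ?_, fun l hl hne => ?_⟩
  · rw [shadow, if_pos ha, pow_one]
    exact ⟨X 1 ^ (if σ.b ∈ σ.δ.E then 1 else 0) * ∏ l ∈ σ.off.filter (fun l => σ.ψ l ≠ 0), σ.ψ l, by ring⟩
  · rw [shadow, if_pos hb, pow_one]
    exact ⟨X 0 ^ (if σ.a ∈ σ.δ.E then 1 else 0) * ∏ l ∈ σ.off.filter (fun l => σ.ψ l ≠ 0), σ.ψ l, by ring⟩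
  · rw [shadow]
    exact Dvd.dvd.mul_left (Finset.dvd_prod_of_mem _ (Finset.mem_filter.mpr ⟨hl, hne⟩)) _

/-- **A NORMAL-CROSSING SHADOW IS MONOMIAL AFTER A TWIST** (OURS · L1 W4.3; memo §2). -/
theorem exists_monomial_twist {σ : SurfDatum k m} (hnc : PlaneGerm.IsNC σ.shadow) :
    ∃ Θ : Fin 2 → MvPowerSeries (Fin 2) k, (∀ t, constantCoeff (Θ t) = 0) ∧ IsUnit (FormalCoordChange.linMat Θ).det ∧
      (σ.a ∈ σ.δ.E → Θ 0 = X 0) ∧ (σ.b ∈ σ.δ.E → Θ 1 = X 1) ∧ ∃ e : Fin (m + 1) → ℕ × ℕ, (σ.twist Θ).IsMonomial e := by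
  classical
  obtain ⟨hXa, hXb, hψdvd⟩ := dvd_shadow σ
  -- a factor basis `Λ`, arranged so that a boundary base letter `a` is `unit · Λ₀` and `b` is `unit · Λ₁`
  obtain ⟨Λ₀, hΛ₀0, hΛ₀det, hfb₀⟩ := factorBasis_of_isNC hnc
  have key : ∃ Λ : Fin 2 → MvPowerSeries (Fin 2) k, (∀ t, constantCoeff (Λ t) = 0) ∧ IsUnit (FormalCoordChange.linMat Λ).det ∧
      (∀ F : MvPowerSeries (Fin 2) k, F ∣ σ.shadow → ∃ (v : MvPowerSeries (Fin 2) k) (p q : ℕ), constantCoeff v ≠ 0 ∧ F = v * Λ 0 ^ p * Λ 1 ^ q) ∧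
      (σ.a ∈ σ.δ.E → ∃ v : MvPowerSeries (Fin 2) k, constantCoeff v ≠ 0 ∧ (X 0 : MvPowerSeries (Fin 2) k) = v * Λ 0) ∧
      (σ.b ∈ σ.δ.E → ∃ v : MvPowerSeries (Fin 2) k, constantCoeff v ≠ 0 ∧ (X 1 : MvPowerSeries (Fin 2) k) = v * Λ 1) := by
    -- decide with which basis series `x_a` (if a boundary letter) resp. `x_b` is associated, and swap the basis if necessary
    have hassoc : ∀ (Λ : Fin 2 → MvPowerSeries (Fin 2) k), (∀ t, constantCoeff (Λ t) = 0) → IsUnit (FormalCoordChange.linMat Λ).det →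
        (∀ F : MvPowerSeries (Fin 2) k, F ∣ σ.shadow → ∃ (v : MvPowerSeries (Fin 2) k) (p q : ℕ), constantCoeff v ≠ 0 ∧ F = v * Λ 0 ^ p * Λ 1 ^ q) →
        ¬ ((∃ v : MvPowerSeries (Fin 2) k, constantCoeff v ≠ 0 ∧ (X 0 : MvPowerSeries (Fin 2) k) = v * Λ 0) ∧
            ∃ v : MvPowerSeries (Fin 2) k, constantCoeff v ≠ 0 ∧ (X 1 : MvPowerSeries (Fin 2) k) = v * Λ 0) := by
      rintro Λ hΛ0 hΛdet - ⟨⟨v, hv, h0⟩, ⟨w, hw, h1⟩⟩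
      -- `x₀` and `x₁` would be associated: compare `x₁`-coefficients
      have hL := eq_inv_mul_X_of hv h0
      rw [hL, ← mul_assoc] at h1
      have hc := congrArg (coeff (Finsupp.single (1 : Fin 2) 1)) h1
      rw [coeff_X, if_pos rfl, coeff_single_unit_mul_X, if_neg (by decide)] at hc
      exact one_ne_zero hc
    by_cases ha : σ.a ∈ σ.δ.E
    · obtain ⟨v, p, q, hv, hv0⟩ := hfb₀ _ (hXa ha)
      rcases X_eq_unit_mul_of_factorBasis hΛ₀0 hv hv0 with h0 | h0
      · refine ⟨Λ₀, hΛ₀0, hΛ₀det, hfb₀, fun _ => ⟨v, hv, h0⟩, fun hb => ?_⟩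
        obtain ⟨w, p', q', hw, hw0⟩ := hfb₀ _ (hXb hb)
        rcases X_eq_unit_mul_of_factorBasis hΛ₀0 hw hw0 with h1 | h1
        · exact absurd ⟨⟨v, hv, h0⟩, ⟨w, hw, h1⟩⟩ (hassoc Λ₀ hΛ₀0 hΛ₀det hfb₀)
        · exact ⟨w, hw, h1⟩
      · obtain ⟨hΛ0', hΛdet', hfb'⟩ := factorBasis_swap hΛ₀0 hΛ₀det hfb₀
        refine ⟨![Λ₀ 1, Λ₀ 0], hΛ0', hΛdet', hfb', fun _ => ⟨v, hv, by simpa using h0⟩, fun hb => ?_⟩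
        obtain ⟨w, p', q', hw, hw0⟩ := hfb' _ (hXb hb)
        rcases X_eq_unit_mul_of_factorBasis hΛ0' hw hw0 with h1 | h1
        · exact absurd ⟨⟨v, hv, by simpa using h0⟩, ⟨w, hw, h1⟩⟩ (hassoc _ hΛ0' hΛdet' hfb')
        · exact ⟨w, hw, h1⟩
    · by_cases hb : σ.b ∈ σ.δ.E
      · obtain ⟨w, p', q', hw, hw0⟩ := hfb₀ _ (hXb hb)
        rcases X_eq_unit_mul_of_factorBasis hΛ₀0 hw hw0 with h1 | h1
        · obtain ⟨hΛ0', hΛdet', hfb'⟩ := factorBasis_swap hΛ₀0 hΛ₀det hfb₀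
          exact ⟨![Λ₀ 1, Λ₀ 0], hΛ0', hΛdet', hfb', fun h => absurd h ha, fun _ => ⟨w, hw, by simpa using h1⟩⟩
        · exact ⟨Λ₀, hΛ₀0, hΛ₀det, hfb₀, fun h => absurd h ha, fun _ => ⟨w, hw, h1⟩⟩
      · exact ⟨Λ₀, hΛ₀0, hΛ₀det, hfb₀, fun h => absurd h ha, fun h => absurd h hb⟩
  obtain ⟨Λ, hΛ0, hΛdet, hfb, hΛa, hΛb⟩ := key
  -- the coordinates `Ξ` to be inverted: the boundary base letters themselves, the basis series elsewhere
  set Ξ : Fin 2 → MvPowerSeries (Fin 2) k := ![if σ.a ∈ σ.δ.E then X 0 else Λ 0, if σ.b ∈ σ.δ.E then X 1 else Λ 1] with hΞ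
  -- each `Ξ t` is a unit times `Λ t`
  have hΞunit : ∀ t : Fin 2, ∃ w : MvPowerSeries (Fin 2) k, constantCoeff w ≠ 0 ∧ Ξ t = w * Λ t := by
    intro t
    fin_cases t
    · by_cases ha : σ.a ∈ σ.δ.E
      · obtain ⟨v, hv, h0⟩ := hΛa ha
        exact ⟨v, hv, by simp [hΞ, ha, h0]⟩
      · exact ⟨1, by simp, by simp [hΞ, ha]⟩
    · by_cases hb : σ.b ∈ σ.δ.E
      · obtain ⟨v, hv, h1⟩ := hΛb hb
        exact ⟨v, hv, by simp [hΞ, hb, h1]⟩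
      · exact ⟨1, by simp, by simp [hΞ, hb]⟩
  obtain ⟨w₀, hw₀, hΞ0⟩ := hΞunit 0
  obtain ⟨w₁, hw₁, hΞ1⟩ := hΞunit 1
  have hΞc : ∀ t, constantCoeff (Ξ t) = 0 := by
    intro t
    fin_cases t
    · show constantCoeff (Ξ 0) = 0
      rw [hΞ0, map_mul, hΛ0, mul_zero]
    · show constantCoeff (Ξ 1) = 0
      rw [hΞ1, map_mul, hΛ0, mul_zero]
  -- `Ξ` is legal: its linear part is the linear part of `Λ` with rows rescaled by units
  have hlin : ∀ (w L : MvPowerSeries (Fin 2) k), constantCoeff L = 0 → ∀ j : Fin 2,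
      coeff (Finsupp.single j 1) (w * L) = constantCoeff w * coeff (Finsupp.single j 1) L := by
    intro w L hL j
    rw [MvPowerSeries.coeff_mul, Finsupp.antidiagonal_single, Finset.sum_map, Finset.Nat.antidiagonal_succ,
      Finset.sum_cons, Finset.Nat.antidiagonal_zero, Finset.map_singleton, Finset.sum_singleton]
    simp only [Function.Embedding.coe_prodMap, Function.Embedding.coeFn_mk, Prod.map_apply,
      Function.Embedding.refl_apply, Finsupp.single_zero, MvPowerSeries.coeff_zero_eq_constantCoeff_apply, hL, mul_zero, add_zero]
  have hΞdet : IsUnit (FormalCoordChange.linMat Ξ).det := by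
    rw [Matrix.det_fin_two] at hΛdet ⊢
    simp only [FormalCoordChange.linMat, Matrix.of_apply] at hΛdet ⊢
    rw [hΞ0, hΞ1, hlin w₀ _ (hΛ0 0), hlin w₀ _ (hΛ0 0), hlin w₁ _ (hΛ0 1), hlin w₁ _ (hΛ0 1)]
    rw [isUnit_iff_ne_zero] at hΛdet ⊢
    rw [show constantCoeff w₀ * coeff (Finsupp.single 0 1) (Λ 0) * (constantCoeff w₁ * coeff (Finsupp.single 1 1) (Λ 1)) -
        constantCoeff w₀ * coeff (Finsupp.single 1 1) (Λ 0) * (constantCoeff w₁ * coeff (Finsupp.single 0 1) (Λ 1)) =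
        constantCoeff w₀ * constantCoeff w₁ * (coeff (Finsupp.single 0 1) (Λ 0) * coeff (Finsupp.single 1 1) (Λ 1) -
          coeff (Finsupp.single 1 1) (Λ 0) * coeff (Finsupp.single 0 1) (Λ 1)) by ring]
    exact mul_ne_zero (mul_ne_zero hw₀ hw₁) hΛdet
  -- `Θ` = the inverse of `Ξ`
  obtain ⟨Θ, hΘ0, hΘΞ, hΞΘ⟩ := FormalCoordChange.exists_comp_inverse hΞc hΞdet
  have hΘ : HasSubst Θ := hasSubst_of_constantCoeff_zero hΘ0
  have hΘdet : IsUnit (FormalCoordChange.linMat Θ).det := TOT2E1.isUnit_det_linMat_of_comp_eq_X hΘ0 hΘΞ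
  refine ⟨Θ, hΘ0, hΘdet, fun ha => ?_, fun hb => ?_, ?_⟩
  · have h := hΘΞ 0
    rw [show Ξ 0 = X 0 by simp [hΞ, ha], subst_X hΘ] at h
    exact h
  · have h := hΘΞ 1
    rw [show Ξ 1 = X 1 by simp [hΞ, hb], subst_X hΘ] at h
    exact h
  · -- the twisted traces are unit monomials: `ψ_l = v Λ₀^p Λ₁^q = v' Ξ₀^p Ξ₁^q`, and `Θ^* Ξ_t = x_t`
    have hΛΞ : ∀ t : Fin 2, ∃ w : MvPowerSeries (Fin 2) k, constantCoeff w ≠ 0 ∧ Λ t = w * Ξ t := by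
      intro t
      obtain ⟨w, hw, h⟩ := hΞunit t
      refine ⟨w⁻¹, ?_, by rw [h, ← mul_assoc, MvPowerSeries.inv_mul_cancel _ hw, one_mul]⟩
      rw [constantCoeff_inv]
      exact inv_ne_zero hw
    obtain ⟨z₀, hz₀, hΛΞ0⟩ := hΛΞ 0
    obtain ⟨z₁, hz₁, hΛΞ1⟩ := hΛΞ 1
    have hF : ∀ l : Fin (m + 1), ∃ (v : MvPowerSeries (Fin 2) k) (p q : ℕ), l ∈ σ.off → σ.ψ l ≠ 0 →
        constantCoeff v ≠ 0 ∧ σ.ψ l = v * Λ 0 ^ p * Λ 1 ^ q := by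
      intro l
      by_cases h : l ∈ σ.off ∧ σ.ψ l ≠ 0
      · obtain ⟨v, p, q, hv, he⟩ := hfb _ (hψdvd l h.1 h.2)
        exact ⟨v, p, q, fun _ _ => ⟨hv, he⟩⟩
      · exact ⟨0, 0, 0, fun hl hne => absurd ⟨hl, hne⟩ h⟩
    choose v p q hvpq using hF
    refine ⟨fun l => (p l, q l), fun l hl => ?_⟩
    rw [twist_ψ]
    by_cases h0 : σ.ψ l = 0
    · exact Or.inl (by rw [h0, ← coe_substAlgHom hΘ, map_zero])
    · right
      obtain ⟨hv, hψl⟩ := hvpq l hl h0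
      refine ⟨subst Θ (v l * z₀ ^ p l * z₁ ^ q l), ?_, ?_⟩
      · rw [TOT2E1.constantCoeff_subst_of_constantCoeff_zero _ hΘ0, map_mul, map_mul, map_pow, map_pow]
        exact mul_ne_zero (mul_ne_zero hv (pow_ne_zero _ hz₀)) (pow_ne_zero _ hz₁)
      · show subst Θ (σ.ψ l) = subst Θ (v l * z₀ ^ p l * z₁ ^ q l) * X 0 ^ p l * X 1 ^ q l
        have hΘΞ' : ∀ s, substAlgHom hΘ (Ξ s) = X s := fun s => by rw [coe_substAlgHom]; exact hΘΞ s
        rw [hψl, hΛΞ0, hΛΞ1, ← coe_substAlgHom hΘ]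
        simp only [map_mul, map_pow, mul_pow, hΘΞ']
        ring

end SurfDatum

end GraphSurf

end TameFourTupleDrop

end Summit.ResolutionOfSingularities.ResolutionOfSingularities.Theorems

end
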